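import Summits.QuantumFields.YangMills.Theorems.LuscherReductionDressedRitzPolyakovLiftTransplantRoot
import Literature.Analysis.OperatorTheory.YangMillsMatrixModelGroundStateSign
import HarnessLib

/-!
# Route `LuscherReduction`, item `DressedRitz` (stmt-QuantumFields-20205), line «polyakovlift» r6 OF RECORD (09c950a55cd7b1f3) —
# THE REGISTERED BASIS PREDICATE `TransplantBasisL` IS NONVACUOUS

Support theorems (fleet seat prover ym-infvol-p1 g7; `--supports stmt-QuantumFields-20205`; F7 of the LEAD's WAVE 2, `WAVE-2-BRIEFS.md` §W2-F7:
«please state nonvacuity for the REGISTERED predicate too: `0 < Λ → Λ ≤ 1/4 → 0 < L → ∃ g, TransplantBasisL k L Λ g` (witness `R = 1/(4Λ)`)»).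
The registered r6 stubs are keyed to `TransplantBasisL k L Λ g` (tree `…PolyakovLiftTransplantRoot.lean`, p554989):
`∃ f R, IsEigenFamily k f ∧ (∀ x, 0 < f 0 x) ∧ 1 ≤ R ∧ 1/8 ≤ R·Λ ∧ R·Λ ≤ 1/4 ∧ ∀ i, g i = transplantObsL L Λ R f i` — an AL1 eigenfamily of Lüscher's
matrix Hamiltonian WITH POSITIVE GROUND STATE, read through the `L`-adapted root chart at a PINNED radius `R ≍ 1/Λ` (cdisprove R6 PRE-VET V1).  Its
nonvacuity is the Literature theorem `exists_eigenfunctions_pos_groundState` (`YangMillsMatrixModelGroundStateSign.lean`, p554854: the invariant ground state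
of `𝔥` does not change sign — core minimizing sequence `χ_Rf_0` + variational Perron–Frobenius + E. Hopf) with the witness radius `R = 1/(4Λ)`:

* `transplantBasisL_nonempty_of_radius` — any admissible radius `1 ≤ R`, `1/8 ≤ RΛ ≤ 1/4` carries a root-transplant basis (with its AL1 family exposed);
* ★ `transplantBasisL_nonempty` — **`0 < Λ → Λ ≤ 1/4 → ∃ g, TransplantBasisL k L Λ g`** for EVERY `L` (the LEAD's requested form with `0 < L` follows a fortiori:
  `transplantBasisL_nonempty'`).

So the ∃-stub S-PSCAL″ (`PScalingExistsForL (TransplantBasisL k)`) has candidates and the ∀-stubs S-STAT″/S-UNIV″/S-LEAK″ are not vacuous.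
HONEST FRAMING: spectral theory of the 9-dimensional matrix model serving the witness of ONE stub of a CONDITIONAL crux on the femto rung R2b1;
no stub is closed here; nothing bears on infinite volume, the continuum limit or the Clay gap.
References: Reed–Simon IV [cite: ReedSimonIV1978, Thm. XIII.47–48]; Lieb–Loss [cite: LiebLoss2001, Thm. 11.8]; M. Lüscher, NPB 219 (1983) 233 [cite: Luscher1983, §2–§3].
-/

set_option autoImplicit false

noncomputable section

open MeasureTheory
open Literature.Analysis.OperatorTheory.YMMatrixModel

namespace Summit.QuantumFields.YangMills.Theorems.FemtoTransferGap.PolyakovLift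

open Summit.QuantumFields.YangMills.Theorems.FemtoTransferGap

/-- **Any admissible radius carries a root-transplant basis**: for `1 ≤ R`, `1/8 ≤ R·Λ ≤ 1/4` and every `L` there is `g` with
`TransplantBasisL k L Λ g`, namely `g_i = transplantObsL L Λ R f i` for an AL1 eigenfamily `f` with `f_0 > 0`.
[cite: ReedSimonIV1978, Thm. XIII.47–48] [cite: Luscher1983, §2–§3] -/
theorem transplantBasisL_nonempty_of_radius (k L : ℕ) {Λ R : ℝ} (hR : 1 ≤ R) (hlo : 1 / 8 ≤ R * Λ) (hhi : R * Λ ≤ 1 / 4) :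
    ∃ g : Fin k → (Cfg → ℝ), TransplantBasisL k L Λ g ∧
      ∃ f : Fin (k + 1) → ZM → ℝ, IsEigenFamily k f ∧ (∀ x, 0 < f 0 x) ∧ ∀ i, g i = transplantObsL L Λ R f i := by
  obtain ⟨f, h1, h2, h3, h4, h5, hpos⟩ := exists_eigenfunctions_pos_groundState k
  exact ⟨fun i => transplantObsL L Λ R f i, ⟨f, R, ⟨h1, h2, h3, h4, h5⟩, hpos, hR, hlo, hhi, fun _ => rfl⟩,
    f, ⟨h1, h2, h3, h4, h5⟩, hpos, fun _ => rfl⟩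

/-- ★ **The registered r6 basis predicate is nonvacuous**: for `0 < Λ ≤ 1/4` and EVERY `L` there is `g` with `TransplantBasisL k L Λ g`
(witness radius `R = 1/(4Λ)`, so `R·Λ = 1/4`). [cite: ReedSimonIV1978, Thm. XIII.47–48] [cite: Luscher1983, §2–§3] -/
theorem transplantBasisL_nonempty (k L : ℕ) {Λ : ℝ} (hΛ : 0 < Λ) (hΛ4 : Λ ≤ 1 / 4) :
    ∃ g : Fin k → (Cfg → ℝ), TransplantBasisL k L Λ g := by
  have hRΛ : 1 / (4 * Λ) * Λ = 1 / 4 := by field_simp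
  have hR : (1 : ℝ) ≤ 1 / (4 * Λ) := by
    rw [le_div_iff₀ (by positivity)]
    linarith
  obtain ⟨g, hg, -⟩ := transplantBasisL_nonempty_of_radius k L (Λ := Λ) (R := 1 / (4 * Λ)) hR
    (by rw [hRΛ]; norm_num) (by rw [hRΛ])
  exact ⟨g, hg⟩

/-- The LEAD's requested shape verbatim (`WAVE-2-BRIEFS.md` §W2-F7): `0 < Λ → Λ ≤ 1/4 → 0 < L → ∃ g, TransplantBasisL k L Λ g`.
[cite: ReedSimonIV1978, Thm. XIII.47–48] [cite: Luscher1983, §2–§3] -/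
theorem transplantBasisL_nonempty' (k : ℕ) {Λ : ℝ} {L : ℕ} (hΛ : 0 < Λ) (hΛ4 : Λ ≤ 1 / 4) (_hL : 0 < L) :
    ∃ g : Fin k → (Cfg → ℝ), TransplantBasisL k L Λ g :=
  transplantBasisL_nonempty k L hΛ hΛ4

end Summit.QuantumFields.YangMills.Theorems.FemtoTransferGap.PolyakovLift

end
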